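import Summits.QuantumFields.BalabanUV.Beta.D1BFx.LocalVertexByPartsSum
import Summits.QuantumFields.BalabanUV.Beta.D1BFx.GluonLocalDipEnds
import Summits.QuantumFields.BalabanUV.Beta.D1BFx.GluonLocalProjRow
import Summits.QuantumFields.BalabanUV.Beta.D1BFx.NeedleColumnLetters

/-!
# `BalabanUV.Beta.D1BFx.GluonLocalDipSum` — road «BF-x» for binder row D1, slot (K), END row `hGrp gN`, «GN-K» (part 3): THE FOUR RANK-ONE TERMS OF THE
# `SbT ⊗ dip` WORD SUMMED OVER THE (1.22) VARIABLE ON THE BY-PARTS FRAME — `|Σ'_w w_μw_ν·biBubble Ga (SbT μ (b+w)) Ga (φ ⊗ ψ)| ≤ K·c(R)·[P·Φ′·C₀(δ)n⁴ + 3·P·Φ·C₁(δ)n³]`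
# (Coulomb end BAD: profile amplitude `P`, flat end GOOD: `Φ`, `Φ′`) and `≤ K·c(R)·[Φ·P′ + 3·Φ·P]·C₀(δ)n⁴` (flat end BAD, Coulomb end GOOD), both orientations

HONEST DEPENDENCY (cell records, verbatim): «continuum YM on T⁴ ⇐ BetaPertH ∧ nine spine estimates (0/9 proved); BetaPertH ⇐ (D1) ∧ (D4) ∧
CAP+tail; G-an2-4 gates asym, D1 and NE2/3/4.»  HONEST FRAMING (cell contract, verbatim): «discharging `BetaPertH` makes Bałaban's UV stability
UNCONDITIONAL — a real constructive-QFT result; it is NOT the continuum limit and NOT the Clay problem.»  THIS MODULE DISCHARGES NOTHING of the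
wall: [folklore] bookkeeping over the summed frames `LocalVertexByPartsSum.exists_SbT_outer_tsum_bound_colGood∕rowGood` (taken as HYPOTHESES with
their `K`, `R`), `GluonLocalDipEnds.window_read`, the owner's `NeedleProjProjRow.sum_exp_scale_le` ∕ `abs_weight_le_sq`, `GluonLocalProjRow.sum_exp_div_nrm_le_cube`,
`NeedleColumnLetters.applyKT_eq_applyK_of_symm`.  EVERY LETTER (the end profiles `P`, `P′`, `Φ`, `Φ′`) IS A HYPOTHESIS; no printed statement is named,
no `def`, no `def … : Prop`, nothing cited, 0 sorry.  Asserts NO bound on any table of the road.  Root-level binders hW ∕ hR-sockets ∕ hSX-socket ∕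
D1Tel ∕ D1Rep — 0 discharged; (K) NOT closed; NOT D1, NOT `BetaPertH`, NOT continuum, NOT Clay.

ABSOLUTE RULE (cell charter, verbatim): «No internally-minted statement may enter as a cited fact. Every hypothesis is either kernel-proved in
this package or a verbatim quotation of a PUBLISHED theorem with page reference. The manuscript(s) under audit are NOT citable for their own
disputed steps — they are the thing under adjudication; programme-internal (2001/route/tribunal) claims are never citable.»

WHY (FINDING F-d1leaf03g13-1, journal 2026-08-21 ≈12:08Z).  The four terms of `dipPiece_eq_outer` pair a COULOMB end (`Ga∇δρ_b`: profile
`P·e∕nrm²`; or `Ga∇ρ_b`: `P·e∕nrm`, unit differences `P′·e∕nrm²`) with a FLAT end (`Ga∇p_b`: `Φ ∝ n⁻³`, `Φ′ ∝ n⁻⁴`; or `Ga∇δp_b`: `Φ ∝ n⁻⁴`).  On the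
by-parts frame the BAD end (the one whose unit differences do not gain: `Ga∇δρ_b`, `Ga∇δp_b`) enters through its VALUES only; the sums are
`Σ_w e ≤ C₀n⁴`, `Σ_w e∕nrm ≤ C₁n³`, and the weight's step modulus `|δ_a(w_μw_ν)| ≤ 3·nrm(w)`.
* §1 [folklore] weights: `abs_weight_le_nrm_sq`, **`abs_weight_step_le`**; scale-`n` `tsum`s: `summable_tsum_exp_le`, `summable_tsum_exp_div_nrm_le`.
* §2 [folklore] **`tsum_term_coulBad_col_le`** (term `∇δρ_b ⊗ ∇p_b`: rowGood), **`tsum_term_coulBad_row_le`** (term `∇p_b ⊗ ∇δρ_b`: colGood).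
PART 3b (`GluonLocalDipSumFlat`): `tsum_term_flatBad_row_le` (term `∇ρ_b ⊗ ∇δp_b`: colGood), `tsum_term_flatBad_col_le` (term `∇δp_b ⊗ ∇ρ_b`: rowGood).
NOT HERE (honest): the word's split into the four terms, the `fullSum` reading, the cell, the letters' instantiation (`GluonLocalDipRow`).
Unit `b2b-balaban-beta-d1-formalise-leaf-03` (gen 13), D1 formalisation swarm, road «BF-x»; `LEAVES-BFx.md` row (N) «GN-K» (part 3a).
-/

noncomputable section

namespace Summit.QuantumFields.BalabanUV.Beta.D1BFx.GluonLocalDipSum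

open Finset
open scoped BigOperators
open Literature.MathematicalPhysics.QuantumFieldTheory.Balaban1983to89
open Literature.MathematicalPhysics.QuantumFieldTheory.Balaban1983to89.Beta
open ExpKernelCalculus (Site MKer)
open DyadicShell (Pt toReal toReal_apply)
open GradedBubbles (IsStep)
open PoissonInterior (nrm nrm_pos one_le_nrm nrm_neg supNorm supNorm_neg)
open Summit.QuantumFields.BalabanUV.Beta.TameKernelCalculus (Spr)
open Summit.QuantumFields.BalabanUV.Beta.D1BFx.PackedKernelSplit (biBubble)
open Summit.QuantumFields.BalabanUV.Beta.D1BFx.RankOneBubble (outer applyK applyKT)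
open Summit.QuantumFields.BalabanUV.Beta.D1BFx.SectorRecut (SbT)
open Summit.QuantumFields.BalabanUV.Beta.D1BFx.GluonLeg (Ga)
open Summit.QuantumFields.BalabanUV.Beta.D1BFx.NeedleColumnLetters (applyKT_eq_applyK_of_symm)
open Summit.QuantumFields.BalabanUV.Beta.D1BFx.NeedleProjProjRow (abs_weight_le_sq sum_exp_scale_le)
open Summit.QuantumFields.BalabanUV.Beta.D1BFx.GluonLocalProjRow (sum_exp_div_nrm_le_cube)
open Summit.QuantumFields.BalabanUV.Beta.D1BFx.LatticeHLSRadial (nrm_eq_max)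
open Summit.QuantumFields.BalabanUV.Beta.D1BFx.LatticeHLSProfiles (supNorm_dyadic)
open Summit.QuantumFields.BalabanUV.Beta.D1BFx.GluonLocalDipEnds (summable_col_mul window_read)

/-! ## §1 The weight and the two scale-`n` sums -/

section Weight

/-- [folklore] `|w_μ·w_ν| ≤ nrm(w)²`. -/
theorem abs_weight_le_nrm_sq (w : Pt) (μ ν : Fin 4) : |toReal w μ * toReal w ν| ≤ nrm (d := 4) w ^ 2 := by
  refine (abs_weight_le_sq w μ ν).trans ?_
  rw [supNorm_dyadic]
  exact pow_le_pow_left₀ (by positivity) (by rw [nrm_eq_max]; exact le_max_right _ _) 2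

/-- [folklore] One coordinate is at most `nrm`. -/
theorem abs_toReal_le_nrm (w : Pt) (i : Fin 4) : |toReal w i| ≤ nrm (d := 4) w := by
  have h1 : ((w i).natAbs : ℝ) ≤ (supNorm (d := 4) w : ℝ) := by exact_mod_cast PoissonInterior.natAbs_le_supNorm w i
  have h2 : |toReal w i| = ((w i).natAbs : ℝ) := by rw [toReal_apply, Nat.cast_natAbs, Int.cast_abs]
  rw [h2, nrm_eq_max]
  exact h1.trans (le_max_right _ _)

/-- [folklore] A unit step has coordinates of modulus `≤ 1`. -/
theorem abs_toReal_step_le {a : Pt} (ha : IsStep a) (i : Fin 4) : |toReal a i| ≤ 1 := by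
  obtain ⟨j, rfl | rfl⟩ := ha
  · rw [toReal_apply, BubbleTransfer.unitVec, Pi.single_apply]
    split_ifs <;> simp
  · rw [toReal_apply, Pi.neg_apply, BubbleTransfer.unitVec, Pi.single_apply]
    split_ifs <;> simp

/-- [folklore] **THE STEP MODULUS OF THE (1.22) WEIGHT**: `|(w−a)_μ(w−a)_ν − w_μw_ν| ≤ 3·nrm(w)` for a unit step `a`. -/
theorem abs_weight_step_le (μ ν : Fin 4) (w a : Pt) (ha : IsStep a) :
    |toReal (w - a) μ * toReal (w - a) ν - toReal w μ * toReal w ν| ≤ 3 * nrm (d := 4) w := by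
  have e : toReal (w - a) μ * toReal (w - a) ν - toReal w μ * toReal w ν
      = -(toReal a μ * toReal w ν) + -(toReal a ν * toReal w μ) + toReal a μ * toReal a ν := by
    simp only [toReal_apply, Pi.sub_apply, Int.cast_sub]; ring
  rw [e]
  have h1 := abs_toReal_step_le ha μ
  have h2 := abs_toReal_step_le ha ν
  have h3 := abs_toReal_le_nrm w μ
  have h4 := abs_toReal_le_nrm w ν
  have h5 := one_le_nrm (d := 4) w
  calc |-(toReal a μ * toReal w ν) + -(toReal a ν * toReal w μ) + toReal a μ * toReal a ν|
      ≤ |-(toReal a μ * toReal w ν)| + |-(toReal a ν * toReal w μ)| + |toReal a μ * toReal a ν| := abs_add_three _ _ _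
    _ = |toReal a μ| * |toReal w ν| + |toReal a ν| * |toReal w μ| + |toReal a μ| * |toReal a ν| := by rw [abs_neg, abs_neg, abs_mul, abs_mul, abs_mul]
    _ ≤ 1 * nrm (d := 4) w + 1 * nrm (d := 4) w + 1 * 1 :=
        add_le_add (add_le_add (mul_le_mul h1 h4 (abs_nonneg _) zero_le_one) (mul_le_mul h2 h3 (abs_nonneg _) zero_le_one))
          (mul_le_mul h1 h2 (abs_nonneg _) zero_le_one)
    _ ≤ 3 * nrm (d := 4) w := by linarith

variable (n : ℕ) [NeZero n]

/-- [folklore] **`Σ'_w P·e^{−(δ∕n)‖w‖} ≤ P·C₀(δ)·n⁴`** (summable; the owner's `sum_exp_scale_le`). -/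
theorem summable_tsum_exp_le {δ P : ℝ} (hδ : 0 < δ) (hP : 0 ≤ P) :
    Summable (fun w : Pt => P * Real.exp (-(δ / n) * supNorm (d := 4) w)) ∧
      ∑' w : Pt, P * Real.exp (-(δ / n) * supNorm (d := 4) w) ≤ P * ((1 + 1296 * ((2 / δ) ^ 3 * (1 + 2 / δ))) * (n : ℝ) ^ 4) := by
  have hfin : ∀ S : Finset Pt, ∑ w ∈ S, P * Real.exp (-(δ / n) * supNorm (d := 4) w) ≤ P * ((1 + 1296 * ((2 / δ) ^ 3 * (1 + 2 / δ))) * (n : ℝ) ^ 4) := by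
    intro S
    rw [← Finset.mul_sum]
    refine mul_le_mul_of_nonneg_left ?_ hP
    have h := sum_exp_scale_le n hδ S
    exact (le_of_eq (Finset.sum_congr rfl fun w _ => by rw [supNorm_dyadic])).trans h
  have hs : Summable (fun w : Pt => P * Real.exp (-(δ / n) * supNorm (d := 4) w)) := summable_of_sum_le (fun w => by positivity) hfin
  exact ⟨hs, hs.tsum_le_of_sum_le hfin⟩

/-- [folklore] **`Σ'_w P·e^{−(δ∕n)‖w‖}∕nrm(w) ≤ P·C₁(δ)·n³`** (summable; the owner's `sum_exp_div_nrm_le_cube`). -/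
theorem summable_tsum_exp_div_nrm_le {δ P : ℝ} (hδ : 0 < δ) (hP : 0 ≤ P) :
    Summable (fun w : Pt => P * (Real.exp (-(δ / n) * supNorm (d := 4) w) / nrm (d := 4) w)) ∧
      ∑' w : Pt, P * (Real.exp (-(δ / n) * supNorm (d := 4) w) / nrm (d := 4) w) ≤ P * ((1 + 432 * ((2 / δ) ^ 2 * (1 + 2 / δ))) * (n : ℝ) ^ 3) := by
  have hfin : ∀ S : Finset Pt, ∑ w ∈ S, P * (Real.exp (-(δ / n) * supNorm (d := 4) w) / nrm (d := 4) w)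
      ≤ P * ((1 + 432 * ((2 / δ) ^ 2 * (1 + 2 / δ))) * (n : ℝ) ^ 3) := by
    intro S
    rw [← Finset.mul_sum]
    exact mul_le_mul_of_nonneg_left (sum_exp_div_nrm_le_cube n hδ S) hP
  have hs : Summable (fun w : Pt => P * (Real.exp (-(δ / n) * supNorm (d := 4) w) / nrm (d := 4) w)) :=
    summable_of_sum_le (fun w => by have := nrm_pos (d := 4) w; positivity) hfin
  exact ⟨hs, hs.tsum_le_of_sum_le hfin⟩

end Weight

/-! ## §2 Coulomb end BAD (values `P·e∕nrm²`), flat end GOOD (`Φ`, `Φ′`) -/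

section CoulBad

variable (n : ℕ) [NeZero n] (a : ℝ) {K : ℝ} {R : ℕ}

/-- [folklore] **TERM `φ ⊗ ψ` WITH THE COULOMB END IN THE COLUMN (BAD) AND THE FLAT END IN THE ROW (GOOD)** — e.g. `∇δρ_b ⊗ ∇p_b` — on the
row-good summed frame: `|Σ'_w w_μw_ν·biBubble Ga (SbT μ (b+w)) Ga (φ⊗ψ)| ≤ K·e^{δR}(R+1)²·P·(Φ′·C₀(δ)n⁴ + 3·Φ·C₁(δ)n³)`. -/
theorem tsum_term_coulBad_col_le (ha : 0 < a) (hK : 0 ≤ K)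
    (hrow : ∀ (κ : Fin 4) (b : Pt) (A B : MKer 4 (Fin 4)) (φ ψ : Pt → Fin 4 → ℝ),
      (∀ (s : Pt) (g : Fin 4), Summable fun x : Pt => ∑ a', ψ x a' * A x s a' g) →
      ∀ (W Φ₀ Φ₁ Γ₀ W₁ : Pt → ℝ), (∀ w, 0 ≤ Φ₀ w) → (∀ w, 0 ≤ Φ₁ w) → (∀ w, 0 ≤ Γ₀ w) →
      (∀ (w q : Pt) (g : Fin 4), DyadicShell.supNorm (q - (b + w)) ≤ R → |applyKT ψ A q g| ≤ Φ₀ w) →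
      (∀ (w q : Pt) (g : Fin 4) (i : Fin 4), DyadicShell.supNorm (q - (b + w)) ≤ R →
        |applyKT ψ A (q + BubbleTransfer.unitVec i) g - applyKT ψ A q g| ≤ Φ₁ w) →
      (∀ (w q : Pt) (f : Fin 4), DyadicShell.supNorm (q - (b + w)) ≤ R → |applyK B φ q f| ≤ Γ₀ w) →
      (∀ (w a' : Pt), IsStep a' → |W (w - a') - W w| ≤ W₁ w) →
      Summable (fun w => |W w| * (Γ₀ w * Φ₁ w)) → Summable (fun w => |W w| * (Γ₀ w * Φ₀ w)) →
      Summable (fun w => W₁ w * (Γ₀ w * Φ₀ w)) →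
      Summable (fun w => W w * biBubble A (SbT κ (b + w)) B (outer φ ψ)) ∧
        |∑' w, W w * biBubble A (SbT κ (b + w)) B (outer φ ψ)| ≤ K * ∑' w, (|W w| * (Γ₀ w * Φ₁ w) + W₁ w * (Γ₀ w * Φ₀ w)))
    (hA : Spr (Ga n a)) {φ ψ : Pt → Fin 4 → ℝ} {δ P Φ Φ' Mψ : ℝ} (hδ : 0 < δ) (hP : 0 ≤ P) (hΦ : 0 ≤ Φ) (hΦ' : 0 ≤ Φ') (b : Pt)
    (hψ : ∀ (x : Pt) (c : Fin 4), |ψ x c| ≤ Mψ)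
    (hG : ∀ (q : Pt) (c : Fin 4), |applyK (Ga n a) φ q c| ≤ P * Real.exp (-(δ / n) * supNorm (d := 4) (q - b)) / nrm (d := 4) (q - b) ^ 2)
    (hF : ∀ (q : Pt) (c : Fin 4), |applyK (Ga n a) ψ q c| ≤ Φ)
    (hF' : ∀ (q : Pt) (c i : Fin 4), |applyK (Ga n a) ψ (q + AffineAveraging.unitVec i) c - applyK (Ga n a) ψ q c| ≤ Φ') (μ ν : Fin 4) :
    Summable (fun w : Pt => toReal w μ * toReal w ν * biBubble (Ga n a) (SbT μ (b + w)) (Ga n a) (outer φ ψ)) ∧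
      |∑' w : Pt, toReal w μ * toReal w ν * biBubble (Ga n a) (SbT μ (b + w)) (Ga n a) (outer φ ψ)|
        ≤ K * (Real.exp (δ * R) * ((R : ℝ) + 1) ^ 2) * P *
          (Φ' * ((1 + 1296 * ((2 / δ) ^ 3 * (1 + 2 / δ))) * (n : ℝ) ^ 4) + 3 * Φ * ((1 + 432 * ((2 / δ) ^ 2 * (1 + 2 / δ))) * (n : ℝ) ^ 3)) := by
  have hn1 : 1 ≤ n := NeZero.one_le
  set c₂ : ℝ := Real.exp (δ * R) * ((R : ℝ) + 1) ^ 2 with hc₂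
  set C₀ : ℝ := (1 + 1296 * ((2 / δ) ^ 3 * (1 + 2 / δ))) * (n : ℝ) ^ 4 with hC₀
  set C₁ : ℝ := (1 + 432 * ((2 / δ) ^ 2 * (1 + 2 / δ))) * (n : ℝ) ^ 3 with hC₁
  -- the majorants as functions of `w`
  set Γ₀ : Pt → ℝ := fun w => P * c₂ * (Real.exp (-(δ / n) * supNorm (d := 4) w) / nrm (d := 4) w ^ 2) with hΓ₀
  set W : Pt → ℝ := fun w => toReal w μ * toReal w ν with hW
  set W₁ : Pt → ℝ := fun w => 3 * nrm (d := 4) w with hW₁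
  have hΓ₀0 : ∀ w, 0 ≤ Γ₀ w := fun w => by have := nrm_pos (d := 4) w; rw [hΓ₀]; positivity
  have hsym : applyKT ψ (Ga n a) = applyK (Ga n a) ψ := applyKT_eq_applyK_of_symm a ha n ψ
  -- window readings
  have hG₀ : ∀ (w q : Pt) (f : Fin 4), DyadicShell.supNorm (q - (b + w)) ≤ R → |applyK (Ga n a) φ q f| ≤ Γ₀ w := fun w q f hq =>
    (hG q f).trans ((window_read hP hδ.le hn1 2 b w q hq).trans (le_of_eq (by simp only [hΓ₀, hc₂])))
  -- the three summabilities and their sums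
  have e1 : ∀ w : Pt, nrm (d := 4) w ^ 2 * (Γ₀ w * Φ') = P * c₂ * Φ' * Real.exp (-(δ / n) * supNorm (d := 4) w) := fun w => by
    have := nrm_pos (d := 4) w; rw [hΓ₀]; field_simp
  have e2 : ∀ w : Pt, W₁ w * (Γ₀ w * Φ) = 3 * P * c₂ * Φ * (Real.exp (-(δ / n) * supNorm (d := 4) w) / nrm (d := 4) w) := fun w => by
    have := nrm_pos (d := 4) w; rw [hΓ₀, hW₁]; field_simp
  obtain ⟨hs1, ht1⟩ := summable_tsum_exp_le n hδ (by positivity : 0 ≤ P * c₂ * Φ')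
  obtain ⟨hs0, ht0⟩ := summable_tsum_exp_le n hδ (by positivity : 0 ≤ P * c₂ * Φ)
  obtain ⟨hs2, ht2⟩ := summable_tsum_exp_div_nrm_le n hδ (by positivity : 0 ≤ 3 * P * c₂ * Φ)
  have hle1 : ∀ w, |W w| * (Γ₀ w * Φ') ≤ P * c₂ * Φ' * Real.exp (-(δ / n) * supNorm (d := 4) w) := fun w => by
    rw [← e1 w]; exact mul_le_mul_of_nonneg_right (abs_weight_le_nrm_sq w μ ν) (mul_nonneg (hΓ₀0 w) hΦ')
  have hle0 : ∀ w, |W w| * (Γ₀ w * Φ) ≤ P * c₂ * Φ * Real.exp (-(δ / n) * supNorm (d := 4) w) := fun w => by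
    have e0 : nrm (d := 4) w ^ 2 * (Γ₀ w * Φ) = P * c₂ * Φ * Real.exp (-(δ / n) * supNorm (d := 4) w) := by
      have := nrm_pos (d := 4) w; rw [hΓ₀]; field_simp
    rw [← e0]; exact mul_le_mul_of_nonneg_right (abs_weight_le_nrm_sq w μ ν) (mul_nonneg (hΓ₀0 w) hΦ)
  have hS1 : Summable (fun w => |W w| * (Γ₀ w * Φ')) :=
    Summable.of_nonneg_of_le (fun w => mul_nonneg (abs_nonneg _) (mul_nonneg (hΓ₀0 w) hΦ')) hle1 hs1
  have hS0 : Summable (fun w => |W w| * (Γ₀ w * Φ)) :=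
    Summable.of_nonneg_of_le (fun w => mul_nonneg (abs_nonneg _) (mul_nonneg (hΓ₀0 w) hΦ)) hle0 hs0
  have hS2 : Summable (fun w => W₁ w * (Γ₀ w * Φ)) := by simp_rw [e2]; exact hs2
  -- the frame
  obtain ⟨hs, hb⟩ := hrow μ b (Ga n a) (Ga n a) φ ψ (fun s g => summable_col_mul hA hψ s g) W (fun _ => Φ) (fun _ => Φ') Γ₀ W₁
    (fun _ => hΦ) (fun _ => hΦ') hΓ₀0 (fun w q g _ => by rw [hsym]; exact hF q g) (fun w q g i _ => by rw [hsym]; exact hF' q g i) hG₀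
    (fun w a' ha' => by rw [hW]; exact abs_weight_step_le μ ν w a' ha') hS1 hS0 hS2
  refine ⟨hs, hb.trans ?_⟩
  rw [hS1.tsum_add hS2]
  have h1 : ∑' w, |W w| * (Γ₀ w * Φ') ≤ P * c₂ * Φ' * C₀ := (hS1.tsum_le_tsum hle1 hs1).trans ht1
  have h2 : ∑' w, W₁ w * (Γ₀ w * Φ) ≤ 3 * P * c₂ * Φ * C₁ := by simp_rw [e2]; exact ht2
  calc K * (∑' w, |W w| * (Γ₀ w * Φ') + ∑' w, W₁ w * (Γ₀ w * Φ)) ≤ K * (P * c₂ * Φ' * C₀ + 3 * P * c₂ * Φ * C₁) :=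
        mul_le_mul_of_nonneg_left (add_le_add h1 h2) hK
    _ = K * c₂ * P * (Φ' * C₀ + 3 * Φ * C₁) := by ring

/-- [folklore] **TERM `φ ⊗ ψ` WITH THE FLAT END IN THE COLUMN (GOOD) AND THE COULOMB END IN THE ROW (BAD)** — e.g. `∇p_b ⊗ ∇δρ_b` — on the
column-good summed frame: the same bound `K·e^{δR}(R+1)²·P·(Φ′·C₀(δ)n⁴ + 3·Φ·C₁(δ)n³)`. -/
theorem tsum_term_coulBad_row_le (ha : 0 < a) (hK : 0 ≤ K)
    (hcol : ∀ (κ : Fin 4) (b : Pt) (A B : MKer 4 (Fin 4)) (φ ψ : Pt → Fin 4 → ℝ),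
      (∀ (s : Pt) (g : Fin 4), Summable fun x : Pt => ∑ a', ψ x a' * A x s a' g) →
      ∀ (W Φ₀ Γ₀ Γ₁ W₁ : Pt → ℝ), (∀ w, 0 ≤ Φ₀ w) → (∀ w, 0 ≤ Γ₀ w) → (∀ w, 0 ≤ Γ₁ w) →
      (∀ (w q : Pt) (g : Fin 4), DyadicShell.supNorm (q - (b + w)) ≤ R → |applyKT ψ A q g| ≤ Φ₀ w) →
      (∀ (w q : Pt) (f : Fin 4), DyadicShell.supNorm (q - (b + w)) ≤ R → |applyK B φ q f| ≤ Γ₀ w) →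
      (∀ (w q : Pt) (f : Fin 4) (i : Fin 4), DyadicShell.supNorm (q - (b + w)) ≤ R →
        |applyK B φ (q + BubbleTransfer.unitVec i) f - applyK B φ q f| ≤ Γ₁ w) →
      (∀ (w a' : Pt), IsStep a' → |W (w - a') - W w| ≤ W₁ w) →
      Summable (fun w => |W w| * (Φ₀ w * Γ₁ w)) → Summable (fun w => |W w| * (Φ₀ w * Γ₀ w)) →
      Summable (fun w => W₁ w * (Φ₀ w * Γ₀ w)) →
      Summable (fun w => W w * biBubble A (SbT κ (b + w)) B (outer φ ψ)) ∧
        |∑' w, W w * biBubble A (SbT κ (b + w)) B (outer φ ψ)| ≤ K * ∑' w, (|W w| * (Φ₀ w * Γ₁ w) + W₁ w * (Φ₀ w * Γ₀ w)))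
    (hA : Spr (Ga n a)) {φ ψ : Pt → Fin 4 → ℝ} {δ P Φ Φ' Mψ : ℝ} (hδ : 0 < δ) (hP : 0 ≤ P) (hΦ : 0 ≤ Φ) (hΦ' : 0 ≤ Φ') (b : Pt)
    (hψ : ∀ (x : Pt) (c : Fin 4), |ψ x c| ≤ Mψ)
    (hF : ∀ (q : Pt) (c : Fin 4), |applyK (Ga n a) ψ q c| ≤ P * Real.exp (-(δ / n) * supNorm (d := 4) (q - b)) / nrm (d := 4) (q - b) ^ 2)
    (hG : ∀ (q : Pt) (c : Fin 4), |applyK (Ga n a) φ q c| ≤ Φ)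
    (hG' : ∀ (q : Pt) (c i : Fin 4), |applyK (Ga n a) φ (q + AffineAveraging.unitVec i) c - applyK (Ga n a) φ q c| ≤ Φ') (μ ν : Fin 4) :
    Summable (fun w : Pt => toReal w μ * toReal w ν * biBubble (Ga n a) (SbT μ (b + w)) (Ga n a) (outer φ ψ)) ∧
      |∑' w : Pt, toReal w μ * toReal w ν * biBubble (Ga n a) (SbT μ (b + w)) (Ga n a) (outer φ ψ)|
        ≤ K * (Real.exp (δ * R) * ((R : ℝ) + 1) ^ 2) * P *
          (Φ' * ((1 + 1296 * ((2 / δ) ^ 3 * (1 + 2 / δ))) * (n : ℝ) ^ 4) + 3 * Φ * ((1 + 432 * ((2 / δ) ^ 2 * (1 + 2 / δ))) * (n : ℝ) ^ 3)) := by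
  have hn1 : 1 ≤ n := NeZero.one_le
  set c₂ : ℝ := Real.exp (δ * R) * ((R : ℝ) + 1) ^ 2 with hc₂
  set C₀ : ℝ := (1 + 1296 * ((2 / δ) ^ 3 * (1 + 2 / δ))) * (n : ℝ) ^ 4 with hC₀
  set C₁ : ℝ := (1 + 432 * ((2 / δ) ^ 2 * (1 + 2 / δ))) * (n : ℝ) ^ 3 with hC₁
  set Φ₀ : Pt → ℝ := fun w => P * c₂ * (Real.exp (-(δ / n) * supNorm (d := 4) w) / nrm (d := 4) w ^ 2) with hΦ₀
  set W : Pt → ℝ := fun w => toReal w μ * toReal w ν with hW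
  set W₁ : Pt → ℝ := fun w => 3 * nrm (d := 4) w with hW₁
  have hΦ₀0 : ∀ w, 0 ≤ Φ₀ w := fun w => by have := nrm_pos (d := 4) w; rw [hΦ₀]; positivity
  have hsym : applyKT ψ (Ga n a) = applyK (Ga n a) ψ := applyKT_eq_applyK_of_symm a ha n ψ
  have hF₀ : ∀ (w q : Pt) (g : Fin 4), DyadicShell.supNorm (q - (b + w)) ≤ R → |applyKT ψ (Ga n a) q g| ≤ Φ₀ w := fun w q g hq => by
    rw [hsym]
    exact (hF q g).trans ((window_read hP hδ.le hn1 2 b w q hq).trans (le_of_eq (by simp only [hΦ₀, hc₂])))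
  have e1 : ∀ w : Pt, nrm (d := 4) w ^ 2 * (Φ₀ w * Φ') = P * c₂ * Φ' * Real.exp (-(δ / n) * supNorm (d := 4) w) := fun w => by
    have := nrm_pos (d := 4) w; rw [hΦ₀]; field_simp
  have e0 : ∀ w : Pt, nrm (d := 4) w ^ 2 * (Φ₀ w * Φ) = P * c₂ * Φ * Real.exp (-(δ / n) * supNorm (d := 4) w) := fun w => by
    have := nrm_pos (d := 4) w; rw [hΦ₀]; field_simp
  have e2 : ∀ w : Pt, W₁ w * (Φ₀ w * Φ) = 3 * P * c₂ * Φ * (Real.exp (-(δ / n) * supNorm (d := 4) w) / nrm (d := 4) w) := fun w => by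
    have := nrm_pos (d := 4) w; rw [hΦ₀, hW₁]; field_simp
  obtain ⟨hs1, ht1⟩ := summable_tsum_exp_le n hδ (by positivity : 0 ≤ P * c₂ * Φ')
  obtain ⟨hs0, ht0⟩ := summable_tsum_exp_le n hδ (by positivity : 0 ≤ P * c₂ * Φ)
  obtain ⟨hs2, ht2⟩ := summable_tsum_exp_div_nrm_le n hδ (by positivity : 0 ≤ 3 * P * c₂ * Φ)
  have hle1 : ∀ w, |W w| * (Φ₀ w * Φ') ≤ P * c₂ * Φ' * Real.exp (-(δ / n) * supNorm (d := 4) w) := fun w => by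
    rw [← e1 w]; exact mul_le_mul_of_nonneg_right (abs_weight_le_nrm_sq w μ ν) (mul_nonneg (hΦ₀0 w) hΦ')
  have hle0 : ∀ w, |W w| * (Φ₀ w * Φ) ≤ P * c₂ * Φ * Real.exp (-(δ / n) * supNorm (d := 4) w) := fun w => by
    rw [← e0 w]; exact mul_le_mul_of_nonneg_right (abs_weight_le_nrm_sq w μ ν) (mul_nonneg (hΦ₀0 w) hΦ)
  have hS1 : Summable (fun w => |W w| * (Φ₀ w * Φ')) :=
    Summable.of_nonneg_of_le (fun w => mul_nonneg (abs_nonneg _) (mul_nonneg (hΦ₀0 w) hΦ')) hle1 hs1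
  have hS0 : Summable (fun w => |W w| * (Φ₀ w * Φ)) :=
    Summable.of_nonneg_of_le (fun w => mul_nonneg (abs_nonneg _) (mul_nonneg (hΦ₀0 w) hΦ)) hle0 hs0
  have hS2 : Summable (fun w => W₁ w * (Φ₀ w * Φ)) := by simp_rw [e2]; exact hs2
  obtain ⟨hs, hb⟩ := hcol μ b (Ga n a) (Ga n a) φ ψ (fun s g => summable_col_mul hA hψ s g) W Φ₀ (fun _ => Φ) (fun _ => Φ') W₁
    hΦ₀0 (fun _ => hΦ) (fun _ => hΦ') hF₀ (fun w q f _ => hG q f) (fun w q f i _ => hG' q f i)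
    (fun w a' ha' => by rw [hW]; exact abs_weight_step_le μ ν w a' ha') hS1 hS0 hS2
  refine ⟨hs, hb.trans ?_⟩
  rw [hS1.tsum_add hS2]
  have h1 : ∑' w, |W w| * (Φ₀ w * Φ') ≤ P * c₂ * Φ' * C₀ := (hS1.tsum_le_tsum hle1 hs1).trans ht1
  have h2 : ∑' w, W₁ w * (Φ₀ w * Φ) ≤ 3 * P * c₂ * Φ * C₁ := by simp_rw [e2]; exact ht2
  calc K * (∑' w, |W w| * (Φ₀ w * Φ') + ∑' w, W₁ w * (Φ₀ w * Φ)) ≤ K * (P * c₂ * Φ' * C₀ + 3 * P * c₂ * Φ * C₁) :=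
        mul_le_mul_of_nonneg_left (add_le_add h1 h2) hK
    _ = K * c₂ * P * (Φ' * C₀ + 3 * Φ * C₁) := by ring

end CoulBad

end Summit.QuantumFields.BalabanUV.Beta.D1BFx.GluonLocalDipSum

end
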